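import Summits.HodgeConjecture.HodgeConjecture.Theorems.WeilTypeLadderAnchorEngine
import Literature.AlgebraicGeometry.HodgeTheory.WeilFamilyReachSimilar
import HarnessLib

/-!
# WeilTypeLadder · the SIMILARITY DOOR: reach-by-similitude ∧ Weil-similar locally algebraic anchors ⟹ R1, R∞

b2b cell `hweil` (packet `run/shared/lean/b2b/hodge-weil/`, `LADDER.md ## CARVER — v4`, C26–C30; DIVERGENCE
D13–D14). Carver, generation 4. TYPING ONLY — nothing is asserted, no `sorry`, every input is a hypothesis BY NAME.

The anchor engine (`Theorems/WeilTypeLadderAnchorEngine.lean`) proves the Weil plane of `(A, φ)` algebraic from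
`WeilReachedFromLocalAnchor n d A φ` (a locally algebraic anchor whose family reaches `A` up to `K`-isogeny).
Door A (`Theorems/WeilTypeLadderLocalAnchor.lean`, prover 2 gen 3) produces REACHED from ONE hyperbolic anchor per
`d` through the reach fact `weilFamilyReach_hyperbolic` — obstructed in dimension 8 for the published toolbox by
the Euler-form barrier. This file types door B: REACHED from a Weil-SIMILAR anchor (same PEL component, Deligne's
marking condition `Motives.IsWeilSimilar`) through the reach fact `weilFamilyReach_similar`
(`Literature/AlgebraicGeometry/HodgeTheory/WeilFamilyReachSimilar.lean`: Deligne LNM 900 pp. 47–52 with the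
isometry as hypothesis; the sign of the similitude is repaired by Landherr's theorem, in the tree as the THEOREM
`Literature.NumberTheory.QuadraticForms.hermitianMatrices_congruent_iff_invariants`), and the typed input node
`HasSimilarLocallyAlgebraicWeilAnchors n d` / `…AwayFromSplit n d` (every Weil-type-`(n,n)` target, resp. every
non-hyperbolic one, has a Weil-similar anchor of type `(n,n)` satisfying the local clause).

* `weilClassesOf_le_algebraicClasses_of_reachSimilar_of_similarAnchor` — one target: fact ∧ a similar locally
  algebraic anchor ∧ a non-zero `(n,n)` Weil class on `A` ⟹ `weilClassesOf A φ n d ≤ algebraicClasses A.X n`.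
* `weilSixfolds_of_reachSimilar_of_similarAnchors` — R1 (= stmt-HodgeConjecture-2524) ⟸
  `weilFamilyReach_similar ∧ ∀ d > 0, HasSimilarLocallyAlgebraicWeilAnchors 3 d`.
* `weilSixfolds_of_floor_of_reachSimilar_of_similarAnchorsAwayFromSplit` — R1 ⟸ F0a (split sixfolds,
  [claim: Markman2025SecantWeil]) ∧ `weilFamilyReach_similar` ∧ `∀ d > 0, HasSimilarLocallyAlgebraicWeilAnchorsAwayFromSplit 3 d`
  — THE door-B statement: only the non-hyperbolic sixfolds need anchors.
* `nonsplitSixfolds_of_reachSimilar_of_similarAnchorsAwayFromSplit` — R1′ likewise (no floor needed).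
* `weilClassesImaginaryQuadratic_of_reachSimilar_of_similarAnchors` — R∞ ⟸ fact ∧ anchors for all `n ≥ 2`, `d`.

The Hodge-type-`(n,n)` witness the fact wants on the target is the rung's own class `c` when `c ≠ 0`; `c = 0` is
algebraic trivially. DAG placement: `LADDER.md` C26/C30 (engine-input node REACHED; door B = F_sim ∧ SIMILAR-LOCAL).

References: [Deligne1982HodgeCycles] proof of Thm. 4.8, Prop. 4.4; [vanGeemen1994HodgeAV] 5.2–5.11;
[Schoen1998HodgeWeilAddendum] §10; [Markman2025SecantWeil] Thm. 1.5.1 (claim, under review);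
[Landherr1936HermitianForms] (tree theorem `hermitianMatrices_congruent_iff_invariants`).
-/

-- every declaration of this problem lives in `Summit.HodgeConjecture.HodgeConjecture.…` (summit = sub-problem)
set_option linter.dupNamespace false

noncomputable section

open CategoryTheory AlgebraicGeometry Limits MonoidalCategory CartesianMonoidalCategory

namespace Summit.HodgeConjecture.HodgeConjecture.WeilTypeLadder

open Literature.AlgebraicGeometry Literature.AlgebraicGeometry.Motives
open Literature.AlgebraicGeometry.HodgeTheory
open Literature.AlgebraicTopology.SingularHomology

/-! ## One target -/

/-- **Door B for one target.** Under `weilFamilyReach_similar`: a `√-d`-Weil `2n`-fold `(A, φ)` (`n, d ≥ 1`)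
carrying a non-zero class of its Weil plane of Hodge type `(n, n)` and admitting a Weil-similar locally algebraic
anchor has its whole Weil plane algebraic. [cite: Deligne1982HodgeCycles, proof of Thm. 4.8]
[cite: Schoen1998HodgeWeilAddendum, §10] -/
theorem weilClassesOf_le_algebraicClasses_of_reachSimilar_of_similarAnchor {n d : ℕ}
    (hF : weilFamilyReach_similar) (hn : 1 ≤ n) (hd : 1 ≤ d) (A : AbelianVariety ℂ) (φ : A ⟶ A)
    (hA : A.dim = 2 * n) (hφ : φ ≫ φ = -(d • 𝟙 A))
    (hWA : ∃ wA : complexBetti A.X (2 * n),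
      wA ∈ weilClassesOf A φ n d ∧ wA ≠ 0 ∧ IsOfHodgeType (2 * n) A.X (2 * n) n n wA)
    (hS : ∃ (eA : ProjectiveEmbedding A.X) (aA : complexBetti (projectiveSpace eA.n ℂ) 2)
      (P : AbelianVariety ℂ) (ψ₀ : P ⟶ P) (e : ProjectiveEmbedding P.X)
      (a : complexBetti (projectiveSpace e.n ℂ) 2) (w : complexBetti P.X (2 * n)),
      IsRationalClass aA ∧ aA ≠ 0 ∧ P.dim = 2 * n ∧ ψ₀ ≫ ψ₀ = -(d • 𝟙 P) ∧ IsRationalClass a ∧ a ≠ 0 ∧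
      w ∈ weilClassesOf P ψ₀ n d ∧ IsRationalClass w ∧ w ≠ 0 ∧ IsOfHodgeType (2 * n) P.X (2 * n) n n w ∧
      WeilAnchorLocalClause n d P
        ((d : ℂ) • complexBetti.map e.ι 2 a + complexBetti.map ψ₀.hom.hom.hom 2 (complexBetti.map e.ι 2 a)) w ∧
      IsWeilSimilar n P ψ₀
        ((d : ℂ) • complexBetti.map e.ι 2 a + complexBetti.map ψ₀.hom.hom.hom 2 (complexBetti.map e.ι 2 a))
        A φ
        ((d : ℂ) • complexBetti.map eA.ι 2 aA +
          complexBetti.map φ.hom.hom.hom 2 (complexBetti.map eA.ι 2 aA))) :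
    weilClassesOf A φ n d ≤ algebraicClasses A.X n :=
  weilClassesOf_le_algebraicClasses_of_reached n d hn hd A φ hA hφ
    (weilReachedFromLocalAnchor_of_similarAnchors_of_reach_similar hF hn hd A φ hA hφ hWA hS)

/-! ## The rungs through door B -/

/-- **R1 (`WeilSixfolds` = stmt-HodgeConjecture-2524) ⟸ reach-by-similitude ∧ Weil-similar locally algebraic
anchors for every `√-d`-Weil sixfold of type `(3,3)`.** [cite: Deligne1982HodgeCycles, proof of Thm. 4.8]
[cite: Schoen1998HodgeWeilAddendum, §10] -/
theorem weilSixfolds_of_reachSimilar_of_similarAnchors (hF : weilFamilyReach_similar)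
    (hS : ∀ d : ℕ, 0 < d → HasSimilarLocallyAlgebraicWeilAnchors 3 d) :
    Theses.SevenfoldWeilCensus.WeilSixfolds := by
  refine weilSixfolds_iff_weilClassesOf.2 ?_
  intro d hd A φ hA _ hφ c _ hH hcW
  by_cases hc0 : c = 0
  · rw [hc0]; exact Submodule.zero_mem _
  · exact weilClassesOf_le_algebraicClasses_of_reachSimilar_of_similarAnchor hF (by norm_num) hd A φ hA hφ
      ⟨c, hcW, hc0, hH⟩ (hS d hd A φ hA hφ ⟨c, hcW, hc0, hH⟩) hcW

/-- **R1′ (`NonsplitSixfolds`) ⟸ reach-by-similitude ∧ Weil-similar locally algebraic anchors for the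
NON-hyperbolic sixfolds.** [cite: Schoen1998HodgeWeilAddendum, §10] [cite: vanGeemen1994HodgeAV, 5.2–5.4] -/
theorem nonsplitSixfolds_of_reachSimilar_of_similarAnchorsAwayFromSplit (hF : weilFamilyReach_similar)
    (hS : ∀ d : ℕ, 0 < d → HasSimilarLocallyAlgebraicWeilAnchorsAwayFromSplit 3 d) :
    NonsplitSixfolds := by
  intro d hd A φ hA _ hφ hns c _ hH hcW
  by_cases hc0 : c = 0
  · rw [hc0]; exact Submodule.zero_mem _
  · exact weilClassesOf_le_algebraicClasses_of_reachSimilar_of_similarAnchor hF (by norm_num) hd A φ hA hφ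
      ⟨c, hcW, hc0, hH⟩ (hS d hd A φ hA hφ hns ⟨c, hcW, hc0, hH⟩) hcW

/-- **THE DOOR-B STATEMENT. R1 (stmt-2524) ⟸ F0a (split sixfolds, the floor) ∧ reach-by-similitude ∧
Weil-similar locally algebraic anchors for the NON-hyperbolic sixfolds** — hyperbolic sixfolds are the floor
[claim: Markman2025SecantWeil, status: under-review, Thm. 1.5.1]; every other sixfold is reached inside its own
PEL component from an anchor of the same similarity class (intended: products `X⁴ × S²`,
[cite: Schoen1998HodgeWeilAddendum, §10]) at which the local clause holds (NOT in print — the research input).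
[cite: Deligne1982HodgeCycles, proof of Thm. 4.8] -/
theorem weilSixfolds_of_floor_of_reachSimilar_of_similarAnchorsAwayFromSplit
    (hF0a : Markman2025_weilClasses_algebraic_hyperbolicSixfold) (hF : weilFamilyReach_similar)
    (hS : ∀ d : ℕ, 0 < d → HasSimilarLocallyAlgebraicWeilAnchorsAwayFromSplit 3 d) :
    Theses.SevenfoldWeilCensus.WeilSixfolds :=
  weilSixfolds_of_nonsplitSixfolds_of_floor hF0a
    (nonsplitSixfolds_of_reachSimilar_of_similarAnchorsAwayFromSplit hF hS)

/-- **R∞ (`WeilClassesImaginaryQuadratic`) ⟸ reach-by-similitude ∧ Weil-similar locally algebraic anchors in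
every dimension `2n ≥ 4` and every `d`.** [cite: Deligne1982HodgeCycles, proof of Thm. 4.8]
[cite: vanGeemen1994HodgeAV, 5.2–5.11] -/
theorem weilClassesImaginaryQuadratic_of_reachSimilar_of_similarAnchors (hF : weilFamilyReach_similar)
    (hS : ∀ n : ℕ, 2 ≤ n → ∀ d : ℕ, 0 < d → HasSimilarLocallyAlgebraicWeilAnchors n d) :
    WeilClassesImaginaryQuadratic := by
  intro n hn d hd A φ hA _ hφ c _ hH hcW
  by_cases hc0 : c = 0
  · rw [hc0]; exact Submodule.zero_mem _
  · exact weilClassesOf_le_algebraicClasses_of_reachSimilar_of_similarAnchor hF (by omega) hd A φ hA hφ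
      ⟨c, hcW, hc0, hH⟩ (hS n hn d hd A φ hA hφ ⟨c, hcW, hc0, hH⟩) hcW

end Summit.HodgeConjecture.HodgeConjecture.WeilTypeLadder

end
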